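import Literature.Geometry.Kaehler.ComplexTorusIntegralLefschetzFormsDiscriminant
import Literature.Geometry.Kaehler.ComplexTorusIntegralHardLefschetzModN
import Literature.GroupTheory.FiniteAbelian.MultiplesIndex
import HarnessLib

/-!
# Hard Lefschetz modulo `N` with the minimal classes on `H¹(X, ℤ)` and `H³(X, ℤ)`: the exact defect
# `[H^{2g−1}(X, ℤ) : γ_{g−1} ∧ H¹(X, ℤ) + N·H^{2g−1}(X, ℤ)] = ∏ₐ gcd(N, d_g/d_a)²` and the kernel `[K_N : N·H¹(X, ℤ)]` of the same order

Layer `Literature/Geometry/Kaehler`, namespace `Literature.Geometry.Kaehler.ComplexTorus`; lane `lit-hodgefound` (Track 2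
foundations library), seat p09, generation 42, row g42-#3b (successor-menu items (c)/(d) of generation 41). THEOREMS ONLY (0 definitions);
no named fact, net debt 0. Sequel of g40-#5 `ComplexTorusIntegralCoLefschetzMinimalClassCokernels` (the cokernels
`H^{2g−1}(X, ℤ)/γ_{g−1} ∧ H¹(X, ℤ) ≃+ ⊕_x ℤ/(d_g/d_{a(x)})` and `H^{2g−1}(X, ℤ)/γ_{g−2} ∧ H³(X, ℤ) ≃+ ⊕_x ℤ/(d_{g−1}/d_{min(a(x), g−1)})`), of
g41-#8 `ComplexTorusIntegralHardLefschetzModN` (`γ_{g−1} ∧ H¹ + N·H^{2g−1} = H^{2g−1} ⟺ gcd(N, d_g/d₁) = 1`), of g41-#2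
`ComplexTorusHardLefschetzMinimalClassModPrimeKernel` (the degree-two analogue for a constant type) and of the generic index formula
`[H : S + N·H] = ∏ⱼ gcd(N, mⱼ)` of `GroupTheory/FiniteAbelian/MultiplesIndex` (g42-#3a).

THE RESULT. Let `(X = E/Φ(ℤ^ι), η)` be a polarised complex torus of type `(d₁, …, d_g)` (`g = j + 2`; ANY presentation `Φ`), `m = γ_{g−1}`
the minimal class (`θ^{∧(g−1)} = ((g−1)!·d₁⋯d_{g−1})·m`), `L = m ∧ (−) : H¹(X, ℤ) → H^{2g−1}(X, ℤ)` and `N ≥ 1`. Reading `L` modulo `N`,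
`L̄ : H¹(X, ℤ/N) → H^{2g−1}(X, ℤ/N)` (both free `ℤ/N`-modules of rank `2g`):

* §1 **COKERNEL: `[H^{2g−1}(X, ℤ) : γ_{g−1} ∧ H¹(X, ℤ) + N·H^{2g−1}(X, ℤ)] = ∏_x gcd(N, d_g/d_{a(x)}) = (∏_{a=1}^{g} gcd(N, d_g/d_a))²`**
  (the letters `x ∈ Fin g ⊕ Fin g`, `a(x)` the index of `x`) — `|coker L̄|`; so `L̄` is onto iff `gcd(N, d_g/d₁) = 1` (g41-#8), and for a
  prime `p` the corank of `L̄` over `𝔽_p` is `2·#{a : p ∣ d_g/d_a}`;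
* §2 **KERNEL: `[K_N : N·H¹(X, ℤ)] = (∏_a gcd(N, d_g/d_a))²` for `K_N = {x ∈ H¹(X, ℤ) : m ∧ x ∈ N·H^{2g−1}(X, ℤ)}`** — `|ker L̄| = |coker L̄|`
  (both `H¹(X, ℤ/N)` and `H^{2g−1}(X, ℤ/N)` have `N^{2g}` elements and `L` is injective over `ℤ`, hard Lefschetz); `L̄` is injective iff
  `gcd(N, d_g/d₁) = 1`, iff it is onto;
* §3 the CO-LEFSCHETZ map of `γ_{g−2}` on `H³(X, ℤ)`: **`[H^{2g−1}(X, ℤ) : γ_{g−2} ∧ H³(X, ℤ) + N·H^{2g−1}(X, ℤ)] = ∏_x gcd(N, d_{g−1}/d_{min(a(x), g−1)})`**.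

Sources (the statements are the tree's readings over `ℤ` and `ℤ/N` of): Lange 2023 §5.4.1 Thm. 5.4.1 and (5.22) (PDF p. 275: hard Lefschetz,
the Lefschetz decomposition — over `ℚ`), §2.5.3 Thm. 2.5.16 / Cor. 2.5.17 (PDF p. 135: `θ^{∧q}` on a symplectic basis), §1.5.1 (PDF p. 51:
types), §1.1.3 Exercise 1.1.6 (8) (`Hᵏ(X, ℤ)` free of rank `C(2g, k)`), §4.2 (PDF p. 204: Poincaré's formula); Voisin 2002 §6.2.3 Thm. 6.25
(PDF p. 125), §7.1.2 (PDF p. 134 L31: `L` acts on integral cohomology), §7.2.2 (PDF p. 142 L10); Hungerford II §2 Lemma 2.5 (PDF p. 137: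
`mG`, `G[m]` on `⊕ ℤ/mⱼ`); Benoist–Debarre 2023 §1 (p. 3: minimal classes).

## Contents (theorems only)

* §0 (private) ranks: `[H¹ : N·H¹] = N^{2g} = [H^{2g−1} : N·H^{2g−1}]`; positivity of the elementary divisors; an index identity.
* §1 `IsPolarizationType.relIndex_map_wedge_integralForms_one_sup_map_nsmul_of_eq_content_smul` (+ `…_eq_sq`).
* §2 `IsPolarizationType.relIndex_map_nsmul_inf_comap_wedge_integralForms_one_of_eq_content_smul` (+ `…_eq_sq`),
  `IsPolarizationType.inf_comap_wedge_integralForms_one_eq_map_nsmul_iff_coprime_of_eq_content_smul`,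
  `IsPolarizationType.inf_comap_wedge_integralForms_one_eq_map_nsmul_iff_sup_map_nsmul_eq_of_eq_content_smul`.
* §3 `IsPolarizationType.relIndex_map_wedge_integralForms_three_sup_map_nsmul_of_eq_content_smul`.

## References

* [cite: Lange2023AbelianVarietiesComplex, §5.4.1 Thm. 5.4.1 and (5.22) (PDF p. 275); §2.5.3 Thm. 2.5.16, Cor. 2.5.17 (PDF p. 135); §1.5.1 (PDF p. 51); §1.1.3 Exercise 1.1.6 (8); §4.2 (PDF p. 204)]
* [cite: VoisinHodgeI2002, §6.2.3 Thm. 6.25 (PDF p. 125); §7.1.2 (PDF p. 134 L31); §7.2.2 (PDF p. 142 L10)]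
* [cite: Hungerford1974, Ch. II §2 Lemma 2.5 (v), (vi) (PDF p. 137)]
* [cite: BenoistDebarre2023SmoothSubvarietiesJacobians, §1 (p. 3)]
-/

noncomputable section

open Module Function
open Literature.LinearAlgebra.Alternating
open Literature.GroupTheory.FiniteAbelian

namespace Literature.Geometry.Kaehler.ComplexTorus

section ModNDefect

/-! ## §0 Bookkeeping (private) -/

/-- `[H₁ : H₁ ∩ L⁻¹(T)] = [L(H₁) : L(H₁) ∩ T]`: the index of a pull-back is the index in the image. [folklore] -/
private theorem relIndex_inf_comap₅₃ {G G' : Type*} [AddCommGroup G] [AddCommGroup G'] (L : G →+ G') (H₁ : AddSubgroup G)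
    (T : AddSubgroup G') : (H₁ ⊓ T.comap L).relIndex H₁ = T.relIndex (H₁.map L) := by
  rw [inf_comm, AddSubgroup.inf_relIndex_right, AddSubgroup.relIndex_comap]

variable {ι : Type*} [Fintype ι] [DecidableEq ι] {E : Type*} [NormedAddCommGroup E] [NormedSpace ℂ E]
  {Φ : (ι → ℝ) ≃L[ℝ] E} {j : ℕ} {η : E [⋀^Fin 2]→L[ℝ] ℝ} {d : Fin (j + 2) → ℕ}

omit [DecidableEq ι] in
/-- `[Hᵏ(X, ℤ) : N·Hᵏ(X, ℤ)] = N^{C(2g, k)}` (`Hᵏ(X, ℤ)` is free of rank `C(2g, k)`). [cite: Lange2023AbelianVarietiesComplex, §1.1.3 Exercise 1.1.6 (8)] -/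
private theorem relIndex_map_nsmul_integralForms₅₃ (Φ : (ι → ℝ) ≃L[ℝ] E) (k N : ℕ) :
    ((integralForms Φ k).map (nsmulAddMonoidHom N)).relIndex (integralForms Φ k) = N ^ (Fintype.card ι).choose k := by
  haveI := free_integralForms Φ k
  haveI := finite_integralForms Φ k
  rw [AddSubgroup.relIndex_map_nsmul]
  congr 1
  exact finrank_integralForms_eq_choose Φ k

omit [DecidableEq ι] in
/-- `[H^{2g−1}(X, ℤ) : N·H^{2g−1}(X, ℤ)] = [H¹(X, ℤ) : N·H¹(X, ℤ)]` (`C(2g, 2g−1) = C(2g, 1)`; `g = j + 2`). [cite: Lange2023AbelianVarietiesComplex, §1.1.3 Exercise 1.1.6 (8)] -/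
private theorem relIndex_map_nsmul_integralForms_codegree_one₅₃ (Φ : (ι → ℝ) ≃L[ℝ] E) (e : Fin (2 * (j + 2)) ≃ ι) (N : ℕ) :
    ((integralForms Φ (2 * j + 3)).map (nsmulAddMonoidHom N)).relIndex (integralForms Φ (2 * j + 3)) =
      ((integralForms Φ 1).map (nsmulAddMonoidHom N)).relIndex (integralForms Φ 1) := by
  rw [relIndex_map_nsmul_integralForms₅₃, relIndex_map_nsmul_integralForms₅₃]
  congr 1
  rw [← Fintype.card_congr e, Fintype.card_fin, show 2 * (j + 2) = 1 + (2 * j + 3) by ring]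
  exact (Nat.choose_symm_add).symm

omit [Fintype ι] [DecidableEq ι] in
/-- The elementary divisors `d_g/d_a` of a type are positive. [cite: Lange2023AbelianVarietiesComplex, §1.5.1 (PDF p. 51)] -/
private theorem div_pos₅₃ (hdvd : ∀ i i' : Fin (j + 2), i ≤ i' → d i ∣ d i') (hpos : ∀ i, 0 < d i) (b a : Fin (j + 2)) (hab : a ≤ b) :
    0 < d b / d a :=
  Nat.div_pos (Nat.le_of_dvd (hpos _) (hdvd _ _ hab)) (hpos _)

/-! ## §1 The cokernel of `γ_{g−1} ∪ (−)` modulo `N` -/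

/-- **The defect of hard Lefschetz modulo `N` in degree one.** For a polarised complex torus of type `(d₁, …, d_g)` (`g = j + 2`; any
presentation), the minimal class `m = γ_{g−1}` (`θ^{∧(g−1)} = ((g−1)!·d₁⋯d_{g−1})·m`) and every `N`:

  `[H^{2g−1}(X, ℤ) : γ_{g−1} ∧ H¹(X, ℤ) + N·H^{2g−1}(X, ℤ)] = ∏_x gcd(N, d_g/d_{a(x)})`

— the order of the cokernel of `γ_{g−1} ∪ (−) : H¹(X, ℤ/N) → H^{2g−1}(X, ℤ/N)` (the cokernel over `ℤ` is `⊕_x ℤ/(d_g/d_{a(x)})`, g40-#5, and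
`[Q : N·Q] = ∏ gcd(N, e_x)` for `Q ≅ ⊕ ℤ/e_x`). [cite: Lange2023AbelianVarietiesComplex, §5.4.1 Thm. 5.4.1 and (5.22) (PDF p. 275); §2.5.3 Cor. 2.5.17 (c) (PDF p. 135); §1.5.1 (PDF p. 51)] [cite: VoisinHodgeI2002, §7.2.2 (PDF p. 142 L10)] [cite: Hungerford1974, Ch. II §2 Lemma 2.5 (v), (vi) (PDF p. 137)] -/
theorem IsPolarizationType.relIndex_map_wedge_integralForms_one_sup_map_nsmul_of_eq_content_smul (hd : IsPolarizationType Φ η d)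
    (hη : IsRiemannForm Φ η) (hle₁ : j + 1 ≤ j + 2) {m : E [⋀^Fin (2 * (j + 1))]→L[ℝ] ℂ}
    (hm : wedgePow (ofRealForm η) (j + 1) = (((j + 1).factorial * ∏ i : Fin (j + 1), d (Fin.castLE hle₁ i) : ℕ) : ℂ) • m) (N : ℕ) :
    ((integralForms Φ 1).map (AddMonoidHom.mk'
        (fun x : E [⋀^Fin 1]→L[ℝ] ℂ ↦ (m.wedge x : E [⋀^Fin (2 * j + 3)]→L[ℝ] ℂ)) (ContinuousAlternatingMap.wedge_add_right _)) ⊔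
        (integralForms Φ (2 * j + 3)).map (nsmulAddMonoidHom N)).relIndex (integralForms Φ (2 * j + 3)) =
      ∏ x : Fin (j + 2) ⊕ Fin (j + 2), Nat.gcd N (d (Fin.last (j + 1)) / d (Sum.elim id id x)) :=
  relIndex_sup_map_nsmulAddMonoidHom_eq_prod_gcd (fun _ ↦ div_pos₅₃ hd.1 (hd.pos hη) _ _ (Fin.le_last _))
    (hd.nonempty_addEquiv_quotient_map_wedge_integralForms_one_of_eq_content_smul hη hle₁ hm) N

/-- **`[H^{2g−1}(X, ℤ) : γ_{g−1} ∧ H¹(X, ℤ) + N·H^{2g−1}(X, ℤ)] = (∏_{a=1}^{g} gcd(N, d_g/d_a))²`** — each index `a` carries the two letters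
`λ_a`, `μ_a`. [cite: Lange2023AbelianVarietiesComplex, §5.4.1 Thm. 5.4.1 and (5.22) (PDF p. 275); §1.5.1 (PDF p. 51)] [cite: Hungerford1974, Ch. II §2 Lemma 2.5 (v), (vi) (PDF p. 137)] -/
theorem IsPolarizationType.relIndex_map_wedge_integralForms_one_sup_map_nsmul_eq_sq_of_eq_content_smul (hd : IsPolarizationType Φ η d)
    (hη : IsRiemannForm Φ η) (hle₁ : j + 1 ≤ j + 2) {m : E [⋀^Fin (2 * (j + 1))]→L[ℝ] ℂ}
    (hm : wedgePow (ofRealForm η) (j + 1) = (((j + 1).factorial * ∏ i : Fin (j + 1), d (Fin.castLE hle₁ i) : ℕ) : ℂ) • m) (N : ℕ) :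
    ((integralForms Φ 1).map (AddMonoidHom.mk'
        (fun x : E [⋀^Fin 1]→L[ℝ] ℂ ↦ (m.wedge x : E [⋀^Fin (2 * j + 3)]→L[ℝ] ℂ)) (ContinuousAlternatingMap.wedge_add_right _)) ⊔
        (integralForms Φ (2 * j + 3)).map (nsmulAddMonoidHom N)).relIndex (integralForms Φ (2 * j + 3)) =
      (∏ a : Fin (j + 2), Nat.gcd N (d (Fin.last (j + 1)) / d a)) ^ 2 := by
  rw [hd.relIndex_map_wedge_integralForms_one_sup_map_nsmul_of_eq_content_smul hη hle₁ hm N, Fintype.prod_sum_type, sq]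
  simp only [Sum.elim_inl, Sum.elim_inr, id_eq]

/-! ## §2 The kernel of `γ_{g−1} ∪ (−)` modulo `N` -/

/-- **The kernel of hard Lefschetz modulo `N` in degree one has the order of the cokernel.** With `m = γ_{g−1}` as above, `N ≥ 1` and
`K_N = {x ∈ H¹(X, ℤ) : m ∧ x ∈ N·H^{2g−1}(X, ℤ)}` (the classes killed by `γ_{g−1} ∪ (−)` modulo `N`; `K_N ⊇ N·H¹(X, ℤ)`):

  `[K_N : N·H¹(X, ℤ)] = ∏_x gcd(N, d_g/d_{a(x)})`

— `|ker L̄| = |coker L̄|` for `L̄ = γ_{g−1} ∪ (−) : H¹(X, ℤ/N) → H^{2g−1}(X, ℤ/N)`: both sides have `N^{2g}` elements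
(`rk H¹ = rk H^{2g−1} = 2g`) and `L` is injective over `ℤ` (hard Lefschetz), so `[H¹ : K_N] = [L(H¹) + N·H : N·H] = N^{2g}/[H : L(H¹) + N·H]`.
[cite: Lange2023AbelianVarietiesComplex, §5.4.1 Thm. 5.4.1 and (5.22) (PDF p. 275); §1.1.3 Exercise 1.1.6 (8); §1.5.1 (PDF p. 51)] [cite: VoisinHodgeI2002, §6.2.3 Thm. 6.25 (PDF p. 125); §7.1.2 (PDF p. 134 L31)] [cite: Hungerford1974, Ch. II §2 Lemma 2.5 (v), (vi) (PDF p. 137)] -/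
theorem IsPolarizationType.relIndex_map_nsmul_inf_comap_wedge_integralForms_one_of_eq_content_smul (hd : IsPolarizationType Φ η d)
    (hη : IsRiemannForm Φ η) (hle₁ : j + 1 ≤ j + 2) {m : E [⋀^Fin (2 * (j + 1))]→L[ℝ] ℂ}
    (hm : wedgePow (ofRealForm η) (j + 1) = (((j + 1).factorial * ∏ i : Fin (j + 1), d (Fin.castLE hle₁ i) : ℕ) : ℂ) • m)
    {N : ℕ} (hN : N ≠ 0) :
    ((integralForms Φ 1).map (nsmulAddMonoidHom N)).relIndex
      (integralForms Φ 1 ⊓ ((integralForms Φ (2 * j + 3)).map (nsmulAddMonoidHom N)).comap (AddMonoidHom.mk'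
        (fun x : E [⋀^Fin 1]→L[ℝ] ℂ ↦ (m.wedge x : E [⋀^Fin (2 * j + 3)]→L[ℝ] ℂ)) (ContinuousAlternatingMap.wedge_add_right _))) =
      ∏ x : Fin (j + 2) ⊕ Fin (j + 2), Nat.gcd N (d (Fin.last (j + 1)) / d (Sum.elim id id x)) := by
  classical
  obtain ⟨Φ', hΛ, hs⟩ := hd.exists_isSymplecticEnum Φ
  have hη' : IsRiemannForm Φ' η := hη.of_range_latticeVec_subset hΛ.le
  have hc := hd.relIndex_map_wedge_integralForms_one_sup_map_nsmul_of_eq_content_smul hη hle₁ hm N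
  set P := ∏ x : Fin (j + 2) ⊕ Fin (j + 2), Nat.gcd N (d (Fin.last (j + 1)) / d (Sum.elim id id x)) with hP
  set L : (E [⋀^Fin 1]→L[ℝ] ℂ) →+ (E [⋀^Fin (2 * j + 3)]→L[ℝ] ℂ) := AddMonoidHom.mk'
    (fun x : E [⋀^Fin 1]→L[ℝ] ℂ ↦ (m.wedge x : E [⋀^Fin (2 * j + 3)]→L[ℝ] ℂ)) (ContinuousAlternatingMap.wedge_add_right _) with hL
  set H₁ := integralForms Φ 1 with hH₁
  set H := integralForms Φ (2 * j + 3) with hH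
  set S := H₁.map L with hS
  set NH := H.map (nsmulAddMonoidHom N) with hNH
  set NH₁ := H₁.map (nsmulAddMonoidHom N) with hNH₁
  have hmZ : m ∈ integralForms Φ (2 * (j + 1)) := by
    rw [← integralForms_eq_of_range_latticeVec_eq hΛ (2 * (j + 1))]
    exact hs.mem_integralForms_of_wedgePow_eq_content_smul Φ' hη' hle₁ hm
  have hSH : S ≤ H := by
    rintro _ ⟨x, hx, rfl⟩
    exact wedge_mem_integralForms Φ hmZ hx
  have hNHH : NH ≤ H := by
    rintro _ ⟨x, hx, rfl⟩
    exact H.nsmul_mem hx N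
  have hNH₁K : NH₁ ≤ H₁ ⊓ NH.comap L := by
    rintro _ ⟨x, hx, rfl⟩
    refine AddSubgroup.mem_inf.2 ⟨H₁.nsmul_mem hx N, ?_⟩
    rw [AddSubgroup.mem_comap, nsmulAddMonoidHom_apply, map_nsmul]
    exact ⟨L x, hSH ⟨x, hx, rfl⟩, rfl⟩
  -- `L` is injective (hard Lefschetz), so `[L(H₁) : L(N·H₁)]`-type transfers are exact: `[H₁ : K] = [S ⊔ NH : NH]`
  have hinj : Function.Injective L := wedge_injective_one_of_wedgePow_eq_smul Φ' (ilvEnum (Equiv.refl _)) hη' hm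
  have hpow : N ^ (Fintype.card ι).choose 1 ≠ 0 := pow_ne_zero _ hN
  have hidx₁ : NH₁.relIndex H₁ = N ^ (Fintype.card ι).choose 1 := relIndex_map_nsmul_integralForms₅₃ Φ 1 N
  have hidx : NH.relIndex H = N ^ (Fintype.card ι).choose 1 := by
    have e : Fin (2 * (j + 2)) ≃ ι := (Fintype.equivFinOfCardEq hd.card_eq).symm
    rw [relIndex_map_nsmul_integralForms_codegree_one₅₃ Φ e N, hidx₁]
  have hKidx : (H₁ ⊓ NH.comap L).relIndex H₁ = NH.relIndex (S ⊔ NH) := by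
    rw [relIndex_inf_comap₅₃, AddSubgroup.relIndex_sup_right]
  have hmul₁ : NH.relIndex (S ⊔ NH) * P = N ^ (Fintype.card ι).choose 1 := by
    rw [← hidx, ← hc, AddSubgroup.relIndex_mul_relIndex NH (S ⊔ NH) H le_sup_right (sup_le hSH hNHH)]
  have hmul₂ : NH₁.relIndex (H₁ ⊓ NH.comap L) * (H₁ ⊓ NH.comap L).relIndex H₁ = N ^ (Fintype.card ι).choose 1 := by
    rw [AddSubgroup.relIndex_mul_relIndex NH₁ (H₁ ⊓ NH.comap L) H₁ hNH₁K inf_le_left, hidx₁]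
  rw [hKidx] at hmul₂
  have hA : NH.relIndex (S ⊔ NH) ≠ 0 := fun h0 ↦ hpow (by rw [← hmul₁, h0, zero_mul])
  refine Nat.eq_of_mul_eq_mul_right (Nat.pos_of_ne_zero hA) ?_
  rw [hmul₂, ← hmul₁, mul_comm]

/-- **`[K_N : N·H¹(X, ℤ)] = (∏_{a=1}^{g} gcd(N, d_g/d_a))²`**. [cite: Lange2023AbelianVarietiesComplex, §5.4.1 Thm. 5.4.1 and (5.22) (PDF p. 275); §1.5.1 (PDF p. 51)] [cite: Hungerford1974, Ch. II §2 Lemma 2.5 (v), (vi) (PDF p. 137)] -/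
theorem IsPolarizationType.relIndex_map_nsmul_inf_comap_wedge_integralForms_one_eq_sq_of_eq_content_smul (hd : IsPolarizationType Φ η d)
    (hη : IsRiemannForm Φ η) (hle₁ : j + 1 ≤ j + 2) {m : E [⋀^Fin (2 * (j + 1))]→L[ℝ] ℂ}
    (hm : wedgePow (ofRealForm η) (j + 1) = (((j + 1).factorial * ∏ i : Fin (j + 1), d (Fin.castLE hle₁ i) : ℕ) : ℂ) • m)
    {N : ℕ} (hN : N ≠ 0) :
    ((integralForms Φ 1).map (nsmulAddMonoidHom N)).relIndex
      (integralForms Φ 1 ⊓ ((integralForms Φ (2 * j + 3)).map (nsmulAddMonoidHom N)).comap (AddMonoidHom.mk'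
        (fun x : E [⋀^Fin 1]→L[ℝ] ℂ ↦ (m.wedge x : E [⋀^Fin (2 * j + 3)]→L[ℝ] ℂ)) (ContinuousAlternatingMap.wedge_add_right _))) =
      (∏ a : Fin (j + 2), Nat.gcd N (d (Fin.last (j + 1)) / d a)) ^ 2 := by
  rw [hd.relIndex_map_nsmul_inf_comap_wedge_integralForms_one_of_eq_content_smul hη hle₁ hm hN, Fintype.prod_sum_type, sq]
  simp only [Sum.elim_inl, Sum.elim_inr, id_eq]

/-- **Injective iff surjective modulo `N` in degree one** (`N ≥ 1`): `K_N = N·H¹(X, ℤ)` — `γ_{g−1} ∪ (−)` is injective on `H¹(X, ℤ/N)` — iff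
`γ_{g−1} ∧ H¹(X, ℤ) + N·H^{2g−1}(X, ℤ) = H^{2g−1}(X, ℤ)` — it is surjective (the two defects have the same order).
[cite: Lange2023AbelianVarietiesComplex, §5.4.1 Thm. 5.4.1 and (5.22) (PDF p. 275); §1.1.3 Exercise 1.1.6 (8)] [cite: VoisinHodgeI2002, §7.1.2 (PDF p. 134 L31)] -/
theorem IsPolarizationType.inf_comap_wedge_integralForms_one_eq_map_nsmul_iff_sup_map_nsmul_eq_of_eq_content_smul
    (hd : IsPolarizationType Φ η d) (hη : IsRiemannForm Φ η) (hle₁ : j + 1 ≤ j + 2) {m : E [⋀^Fin (2 * (j + 1))]→L[ℝ] ℂ}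
    (hm : wedgePow (ofRealForm η) (j + 1) = (((j + 1).factorial * ∏ i : Fin (j + 1), d (Fin.castLE hle₁ i) : ℕ) : ℂ) • m)
    {N : ℕ} (hN : N ≠ 0) :
    integralForms Φ 1 ⊓ ((integralForms Φ (2 * j + 3)).map (nsmulAddMonoidHom N)).comap (AddMonoidHom.mk'
        (fun x : E [⋀^Fin 1]→L[ℝ] ℂ ↦ (m.wedge x : E [⋀^Fin (2 * j + 3)]→L[ℝ] ℂ)) (ContinuousAlternatingMap.wedge_add_right _)) =
      (integralForms Φ 1).map (nsmulAddMonoidHom N) ↔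
    (integralForms Φ 1).map (AddMonoidHom.mk'
        (fun x : E [⋀^Fin 1]→L[ℝ] ℂ ↦ (m.wedge x : E [⋀^Fin (2 * j + 3)]→L[ℝ] ℂ)) (ContinuousAlternatingMap.wedge_add_right _)) ⊔
        (integralForms Φ (2 * j + 3)).map (nsmulAddMonoidHom N) = integralForms Φ (2 * j + 3) := by
  classical
  obtain ⟨Φ', hΛ, hs⟩ := hd.exists_isSymplecticEnum Φ
  have hmZ : m ∈ integralForms Φ (2 * (j + 1)) := by
    rw [← integralForms_eq_of_range_latticeVec_eq hΛ (2 * (j + 1))]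
    exact hs.mem_integralForms_of_wedgePow_eq_content_smul Φ' (hη.of_range_latticeVec_subset hΛ.le) hle₁ hm
  set L : (E [⋀^Fin 1]→L[ℝ] ℂ) →+ (E [⋀^Fin (2 * j + 3)]→L[ℝ] ℂ) := AddMonoidHom.mk'
    (fun x : E [⋀^Fin 1]→L[ℝ] ℂ ↦ (m.wedge x : E [⋀^Fin (2 * j + 3)]→L[ℝ] ℂ)) (ContinuousAlternatingMap.wedge_add_right _) with hL
  have hSH : (integralForms Φ 1).map L ≤ integralForms Φ (2 * j + 3) := by
    rintro _ ⟨x, hx, rfl⟩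
    exact wedge_mem_integralForms Φ hmZ hx
  have hNHH : (integralForms Φ (2 * j + 3)).map (nsmulAddMonoidHom N) ≤ integralForms Φ (2 * j + 3) := by
    rintro _ ⟨x, hx, rfl⟩
    exact (integralForms Φ (2 * j + 3)).nsmul_mem hx N
  have hNH₁K : (integralForms Φ 1).map (nsmulAddMonoidHom N) ≤
      integralForms Φ 1 ⊓ ((integralForms Φ (2 * j + 3)).map (nsmulAddMonoidHom N)).comap L := by
    rintro _ ⟨x, hx, rfl⟩
    refine AddSubgroup.mem_inf.2 ⟨(integralForms Φ 1).nsmul_mem hx N, ?_⟩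
    rw [AddSubgroup.mem_comap, nsmulAddMonoidHom_apply, map_nsmul]
    exact ⟨L x, hSH ⟨x, hx, rfl⟩, rfl⟩
  have hK := hd.relIndex_map_nsmul_inf_comap_wedge_integralForms_one_of_eq_content_smul hη hle₁ hm hN
  have hC := hd.relIndex_map_wedge_integralForms_one_sup_map_nsmul_of_eq_content_smul hη hle₁ hm N
  constructor
  · intro hinj
    refine le_antisymm (sup_le hSH hNHH) (AddSubgroup.relIndex_eq_one.1 ?_)
    rw [hC, ← hK, hinj, AddSubgroup.relIndex_self]
  · intro hsurj
    refine le_antisymm ?_ hNH₁K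
    refine AddSubgroup.relIndex_eq_one.1 ?_
    rw [hK, ← hC, hsurj, AddSubgroup.relIndex_self]

/-- **`γ_{g−1} ∪ (−)` is injective on `H¹(X, ℤ/N)` iff `gcd(N, d_g/d₁) = 1`** (`N ≥ 1`; equivalently onto, g41-#8): `K_N = N·H¹(X, ℤ)` iff no
elementary divisor `d_g/d_a` shares a factor with `N`, iff the largest, `d_g/d₁`, is prime to `N`.
[cite: Lange2023AbelianVarietiesComplex, §5.4.1 Thm. 5.4.1 and (5.22) (PDF p. 275); §1.5.1 (PDF p. 51)] [cite: VoisinHodgeI2002, §7.1.2 (PDF p. 134 L31)] [cite: Hungerford1974, Ch. II §2 Lemma 2.5 (v), (vi) (PDF p. 137)] -/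
theorem IsPolarizationType.inf_comap_wedge_integralForms_one_eq_map_nsmul_iff_coprime_of_eq_content_smul (hd : IsPolarizationType Φ η d)
    (hη : IsRiemannForm Φ η) (hle₁ : j + 1 ≤ j + 2) {m : E [⋀^Fin (2 * (j + 1))]→L[ℝ] ℂ}
    (hm : wedgePow (ofRealForm η) (j + 1) = (((j + 1).factorial * ∏ i : Fin (j + 1), d (Fin.castLE hle₁ i) : ℕ) : ℂ) • m)
    {N : ℕ} (hN : N ≠ 0) :
    integralForms Φ 1 ⊓ ((integralForms Φ (2 * j + 3)).map (nsmulAddMonoidHom N)).comap (AddMonoidHom.mk'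
        (fun x : E [⋀^Fin 1]→L[ℝ] ℂ ↦ (m.wedge x : E [⋀^Fin (2 * j + 3)]→L[ℝ] ℂ)) (ContinuousAlternatingMap.wedge_add_right _)) =
      (integralForms Φ 1).map (nsmulAddMonoidHom N) ↔ Nat.Coprime N (d (Fin.last (j + 1)) / d 0) := by
  rw [hd.inf_comap_wedge_integralForms_one_eq_map_nsmul_iff_sup_map_nsmul_eq_of_eq_content_smul hη hle₁ hm hN,
    hd.map_wedge_integralForms_one_sup_map_nsmul_eq_iff_coprime_of_eq_content_smul hη hle₁ hm N]

/-! ## §3 The co-Lefschetz map of `γ_{g−2}` on `H³(X, ℤ)` modulo `N` -/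

/-- **The defect of the co-Lefschetz map of the minimal class on `H³(X, ℤ)` modulo `N`** (`g = j + 2`; `θ^{∧(g−2)} = ((g−2)!·d₁⋯d_{g−2})·γ`,
any presentation, every `N`):

  `[H^{2g−1}(X, ℤ) : γ_{g−2} ∧ H³(X, ℤ) + N·H^{2g−1}(X, ℤ)] = ∏_x gcd(N, d_{g−1}/d_{min(a(x), g−1)})`

(the cokernel over `ℤ` is `⊕_x ℤ/(d_{g−1}/d_{min(a(x), g−1)})`, g40-#5 §2). [cite: Lange2023AbelianVarietiesComplex, §5.4.1 Thm. 5.4.1 and (5.22) (PDF p. 275); §1.5.1 (PDF p. 51)] [cite: VoisinHodgeI2002, §7.1.2 (PDF p. 134 L31)] [cite: Hungerford1974, Ch. II §2 Lemma 2.5 (v), (vi) (PDF p. 137)] -/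
theorem IsPolarizationType.relIndex_map_wedge_integralForms_three_sup_map_nsmul_of_eq_content_smul (hd : IsPolarizationType Φ η d)
    (hη : IsRiemannForm Φ η) (hle₂ : j ≤ j + 2) {γ : E [⋀^Fin (2 * j)]→L[ℝ] ℂ}
    (hγ : wedgePow (ofRealForm η) j = ((j.factorial * ∏ i : Fin j, d (Fin.castLE hle₂ i) : ℕ) : ℂ) • γ) (N : ℕ) :
    ((integralForms Φ 3).map (AddMonoidHom.mk' (fun x : E [⋀^Fin 3]→L[ℝ] ℂ ↦ γ.wedge x) (ContinuousAlternatingMap.wedge_add_right _)) ⊔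
        (integralForms Φ (2 * j + 3)).map (nsmulAddMonoidHom N)).relIndex (integralForms Φ (2 * j + 3)) =
      ∏ x : Fin (j + 2) ⊕ Fin (j + 2), Nat.gcd N (d ((Fin.last j).castSucc) /
        d (if Sum.elim id id x = Fin.last (j + 1) then ((Fin.last j).castSucc : Fin (j + 2)) else Sum.elim id id x)) := by
  refine relIndex_sup_map_nsmulAddMonoidHom_eq_prod_gcd (fun x ↦ div_pos₅₃ hd.1 (hd.pos hη) _ _ ?_)
    (hd.nonempty_addEquiv_quotient_map_wedge_integralForms_three_of_eq_content_smul hη hle₂ hγ) N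
  by_cases hx : Sum.elim id id x = Fin.last (j + 1)
  · rw [if_pos hx]
  · rw [if_neg hx]
    refine Fin.le_def.2 ?_
    have hne : ((Sum.elim id id x : Fin (j + 2)) : ℕ) ≠ j + 1 := fun h' ↦ hx (Fin.ext (by rw [h', Fin.val_last]))
    rw [Fin.val_castSucc, Fin.val_last]
    have hlt := (Sum.elim id id x).isLt
    omega

end ModNDefect

end Literature.Geometry.Kaehler.ComplexTorus
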